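import Literature.NumberTheory.Automorphic.ReductiveDualProofs
import Literature.NumberTheory.Automorphic.GaussCellGL
import Literature.NumberTheory.Automorphic.TorusCharacters
import Literature.NumberTheory.Automorphic.RootSubgroupCommutators
import HarnessLib

/-!
# The open big cell: reduction of `nonempty_bigCellChart` to Springer 8.2.1 and 8.3.11
(trunk T-AUTOMORPHIC, G25 AutomorphicL)

Companion to `BigCell.lean`, `GaussCellGL.lean` and `ReductiveDualProofs.lean` (namespace
`Literature.Automorphic`; `k`-points vocabulary of items I1–I2: `G, T ≤ GL n k`, root homomorphisms
`IsRootHom`, root data `IsRootDatumOf`, regular functions `IsRegularOnGL`). The named fact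
`nonempty_bigCellChart` of `BigCell.lean` — the inverse chart of the open big cell `U⁻ T U` of a
connected reductive `G` (Springer, *Linear Algebraic Groups*, 2nd ed., 8.3.6 (ii) and 8.3.11 with
8.2.1), which is the input to step 2 of Springer's proof of the isomorphism theorem 9.6.2
(`ReductiveDualProofs.lean`, `isAlgebraicGL_of_inducesRootDatumId_of_bigCell`) — bundles
three printed statements: the product structure `𝔾ₐ^m ≅ B_u` of 8.2.1, the openness of the big
cell 8.3.11, and the *regularity of the inverse* of the product map `U⁻ × T × U → Ω`, which
Springer obtains in 8.3.6 (ii) from the separability criterion 5.3.2 (iii) ("we skip the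
details"). This file proves the third from the first two inside `GL_n`, where it is elementary,
and so reduces `nonempty_bigCellChart` to two single-numbered facts:

* `posRootGroup G P u y = U(y) = ⟨u_i(𝔾ₐ) : ⟨α_i, y⟩ > 0⟩` (definition) for a coweight `y`; for
  `y` regular (no root vanishes on `y`; such `y` exist, `RootPairing.exists_forall_root'_ne_zero`,
  a pigeonhole argument) `R⁺(y)` is a system of positive roots (7.4.5) and `U(y)` is the
  unipotent radical of the Borel subgroup `B(y) ⊇ T` of `R⁺(y)` (8.2.4 (i), 8.2.1, 8.1.1 (i)).
* `posRootGroup_prodIso` (**named fact, Springer 8.2.1**): for any numbering `(α_i)_{i ∈ l}` of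
  `R⁺(y)`, `x ↦ ∏_{i ∈ l} u_i(x_i)` maps `k^m` onto `U(y)` and has a polynomial left inverse
  `(q_i)` (i.e. is an isomorphism of varieties `𝔾ₐ^m ≅ U(y)`).
* `bigCell_nhds_one` (**named fact, Springer 8.3.11 with 8.3.6 (ii)**, translated by `ẇ₀⁻¹`):
  the big cell `Ω = U(-y) · T · U(y)` contains an open neighbourhood `G ∩ ⋃_{e ∈ E} {e ≠ 0}` of
  `1` in `G`.
* **Proved**: `nonempty_bigCellChart_of_facts : posRootGroup_prodIso G T → bigCell_nhds_one G T →
  nonempty_bigCellChart`, whence (namespace `Literature.Lang`)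
  `isAlgebraicGL_of_inducesRootDatumId_of_facts` and **`chevalley_isomorphism_of_facts`**:
  `chevalley_isomorphism_abstract → posRootGroup_prodIso (G, T), (G', T') →
  bigCell_nhds_one (G, T), (G', T') → chevalley_isomorphism`.

The proof of the reduction: choose `y` regular and a matrix `A` conjugating the torus `T` into
the diagonal torus (`exists_conj_le_diagonalSubgroup`, `TorusCharacters.lean`; Springer 2.4.2
(ii)); let `m_j = ⟨χ_j, A λ_y A⁻¹⟩` be the weights of the cocharacter `λ_y` in this basis
(`cocharWeight`, `conj_cochar_eq_diagonal`; 3.2.11 (i)). The torus relation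
`λ_y(c) u_α(x) λ_y(c)⁻¹ = u_α(c^{⟨α, y⟩} x)` forces the `(i, j)` entry of `A u_α(x) A⁻¹`, a
polynomial `p(x)` with `p(c^h x) = c^{m_i - m_j} p(x)`, to be `δ_{ij}` unless `m_i - m_j` is a
positive multiple of `h = ⟨α, y⟩` (`Polynomial.eq_C_of_eval_zpow_mul`,
`apply_eq_one_apply_of_diagonal_conj`: the characters `c ↦ c^e` of `kˣ` are distinct over an
infinite field). Hence `A U(y) A⁻¹` consists of block upper unipotent and `A U(-y) A⁻¹` of block
lower unipotent matrices for the weight function `-m` (`IsRootHom.isBlockUpperUnipotent_conj`,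
`IsRootHom.isBlockLowerUnipotent_conj`), while `A T A⁻¹` is diagonal. So for `g = v t w` in the
big cell, `A g A⁻¹ = (A v A⁻¹)(A t A⁻¹)(A w A⁻¹)` is a Gauss (block `LDU`) decomposition in `GL_n`,
whose factors are unique and are rational functions of `g`, regular on the principal open set
`{∏ Δ ≠ 0} ∋ 1` (`gauss_unique`, `isRegularOnGL_gaussL/D/U` of `GaussCellGL.lean`); composing
with the polynomial inverses `q_i` of 8.2.1 gives the regular coordinates `x_i, y_i, t` of a
`BigCellChart` (`nonempty_bigCellChart_of_gauss`).

Remaining DAG for `Literature.Lang.chevalley_isomorphism_holds` (see also `ReductiveDualProofs.lean`):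
`chevalley_isomorphism_abstract` (Springer 9.6.2, step 1: presentation 9.4.3, 9.5.4, 8.1.4),
`posRootGroup_prodIso` (8.2.1: 8.2.2 via Lie algebras and dimensions, 8.2.3, 8.2.4 (i)) and
`bigCell_nhds_one` (8.3.11: Bruhat's lemma 8.3.8, 8.3.5–8.3.6, dimension 8.1.3 (ii), orbits
2.3.3), all resting on the structure theory of Ch. 6–8 for this vocabulary.

## On faithfulness

* Springer 7.4.5 defines a system of positive roots as `{α | (α, x) > 0}` for `x ∈ V = ℝ ⊗ X`
  with `(α, x) ≠ 0` for all roots, `( , )` a `W`-invariant inner product; since `X` and `X^∨`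
  are in perfect duality, the linear forms `⟨·, y⟩`, `y ∈ X^∨` regular, are among these, so
  `R⁺(y)` is a system of positive roots and 8.2.4 (i), 8.2.1, 8.3.6, 8.3.11 apply to it (with
  the Borel subgroup `B(y) ⊇ T`, `R⁺(B(y)) = R⁺(y)`, of 8.2.4 (i)).
* For a root homomorphism `u_i` of `α_i` in the sense of `IsRootHom`, `u_i(𝔾ₐ)` is Springer's
  `U_{α_i}` by the uniqueness clause of 8.1.1 (i) (`rootSubgroup_unique` of `RootData.lean`), so
  `posRootGroup G P u y` is the group generated by the `U_α`, `α ∈ R⁺(y)`, i.e. `B(y)_u` (8.2.1,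
  "in particular").
* `posRootGroup_prodIso` is 8.2.1 for `B(y)` minus the words "isomorphism of varieties", kept as
  surjectivity onto `B(y)_u` plus a polynomial left inverse (a regular function on the closed
  subvariety `B(y)_u ⊆ GL_n` is the restriction of a polynomial in the coordinates, 1.4.6 with
  1.3); `bigCell_nhds_one` is a consequence of 8.3.11 (openness of `C(w₀) = U ẇ₀ B`, 8.3.6 (ii))
  after translation by `ẇ₀⁻¹` (`ẇ₀⁻¹ U ẇ₀ = U⁻` by 8.1.12 (2) and `w₀ R⁺ = -R⁺`, 8.2.4 (ii))
  and of the fact that principal open sets form a basis of the Zariski topology; both are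
  weaker than the printed statements. Characteristic `0` is assumed only because the consumer
  `nonempty_bigCellChart` assumes it.

## References

* T. A. Springer, *Linear Algebraic Groups*, 2nd ed., Progress in Mathematics 9, Birkhäuser
  (1998) [SpringerLAG1998]: 1.3.5, 1.4.6, 2.4.2 (ii), 3.2.2–3.2.3, 3.2.11 (i), 7.4.5, 8.1.1 (i),
  8.1.12 (2), 8.2.1, 8.2.2, 8.2.4, 8.3.5, 8.3.6 (ii), 8.3.9, 8.3.11, and the proof of 9.6.2.
* J. E. Humphreys, *Linear Algebraic Groups*, GTM 21, Springer (1975), §28.5 (the big cell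
  `Ω = U⁻ B` is open and `U⁻ × B → Ω` is an isomorphism).
-/

open scoped MatrixGroups IsMulCommutative
open Matrix Polynomial

noncomputable section

namespace Literature.NumberTheory.Automorphic

/-! ### Generic coweights: a finite family of non-zero linear forms has a common non-zero -/

section Generic

/-- **A finite family of non-zero additive maps `Y → ℤ` has a common point where none vanishes**
(pigeonhole on the line `y₀ + t z`: each form vanishes at no more than one `t`). [folklore] -/
theorem exists_forall_apply_ne_zero {Y : Type*} [AddCommGroup Y] {ι : Type*} (s : Finset ι)
    (f : ι → Y →+ ℤ) (hf : ∀ i ∈ s, f i ≠ 0) : ∃ y : Y, ∀ i ∈ s, f i y ≠ 0 := by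
  classical
  induction s using Finset.induction_on with
  | empty => exact ⟨0, by simp⟩
  | insert a s ha ih =>
    obtain ⟨y₀, hy₀⟩ := ih fun i hi => hf i (Finset.mem_insert_of_mem hi)
    have hfa : f a ≠ 0 := hf a (Finset.mem_insert_self a s)
    obtain ⟨z, hz⟩ : ∃ z, f a z ≠ 0 :=
      not_forall.mp fun h => hfa (AddMonoidHom.ext h)
    -- the bad parameters `t`
    set B : Set ℤ := ⋃ i ∈ insert a s, {t : ℤ | f i y₀ + t * f i z = 0} with hB
    have hBfin : B.Finite := by
      refine Set.Finite.biUnion (insert a s).finite_toSet fun i hi => ?_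
      by_cases hiz : f i z = 0
      · -- then `i ≠ a`, so `i ∈ s` and `f i y₀ ≠ 0`: the set is empty
        have his : i ∈ s := by
          rcases Finset.mem_insert.mp hi with rfl | h
          · exact absurd hiz hz
          · exact h
        have : {t : ℤ | f i y₀ + t * f i z = 0} = ∅ :=
          Set.eq_empty_of_forall_notMem fun t ht => hy₀ i his (by simpa [hiz] using ht)
        rw [this]
        exact Set.finite_empty
      · refine Set.Subsingleton.finite fun t ht t' ht' => ?_
        have h1 : f i y₀ + t * f i z = 0 := ht
        have h2 : f i y₀ + t' * f i z = 0 := ht'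
        have h3 : (t - t') * f i z = 0 := by rw [sub_mul]; omega
        rcases mul_eq_zero.mp h3 with h | h
        · omega
        · exact absurd h hiz
    obtain ⟨t, ht⟩ := hBfin.exists_notMem
    refine ⟨y₀ + t • z, fun i hi => ?_⟩
    have hti : ¬(f i y₀ + t * f i z = 0) := by
      intro h0
      exact ht (Set.mem_biUnion (x := i) (Finset.mem_coe.mpr hi) h0)
    rwa [map_add, map_zsmul, smul_eq_mul]

/-- For a finite root pairing over `ℤ` there is a coweight `y` on which no root vanishes, i.e.
`y` is *regular*: `R⁺(y) = {α | ⟨α, y⟩ > 0}` is then a system of positive roots (Springer 7.4.5)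
and every root is either `y`-positive or `y`-negative. [folklore] -/
theorem _root_.RootPairing.exists_forall_root'_ne_zero {ι X Y : Type*} [AddCommGroup X]
    [AddCommGroup Y] [Finite ι] (P : RootPairing ι ℤ X Y) :
    ∃ y : Y, ∀ i, P.root' i y ≠ 0 := by
  classical
  haveI := Fintype.ofFinite ι
  obtain ⟨y, hy⟩ := exists_forall_apply_ne_zero (Finset.univ : Finset ι)
    (fun i => (P.root' i).toAddMonoidHom) fun i _ h0 => by
      have h2 := P.root'_coroot_eq_pairing i i
      rw [P.pairing_same] at h2
      have : (P.root' i).toAddMonoidHom (P.coroot i) = 0 := by rw [h0]; rfl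
      rw [LinearMap.toAddMonoidHom_coe, h2] at this
      exact two_ne_zero this
  exact ⟨y, fun i => hy i (Finset.mem_univ i)⟩

end Generic

/-! ### The groups of block unipotent matrices -/

section BlockGroups

variable (k : Type*) [Field k] {n : Type*} [Fintype n] [DecidableEq n]
variable {α : Type*} [LinearOrder α]

variable {k} in
/-- Products of block upper unipotent matrices are block upper unipotent. [folklore] -/
theorem IsBlockUpperUnipotent.mul {b : n → α} {r s : Matrix n n k} (hr : IsBlockUpperUnipotent b r)
    (hs : IsBlockUpperUnipotent b s) : IsBlockUpperUnipotent b (r * s) := by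
  refine ⟨hr.1.mul hs.1, fun i j hij => ?_⟩
  have hblk := toSquareBlock_mul_of_blockTriangular b hr.1 hs.1 (b j)
  rw [hr.toSquareBlock_eq_one, hs.toSquareBlock_eq_one, Matrix.one_mul] at hblk
  have h := congr_fun (congr_fun hblk ⟨i, hij⟩) ⟨j, rfl⟩
  simp only [toSquareBlock_def, of_apply] at h
  rw [h, Matrix.one_apply, Matrix.one_apply]
  simp [Subtype.ext_iff]

variable {k} in
/-- Products of block lower unipotent matrices are block lower unipotent. [folklore] -/
theorem IsBlockLowerUnipotent.mul {b : n → α} {r s : Matrix n n k} (hr : IsBlockLowerUnipotent b r)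
    (hs : IsBlockLowerUnipotent b s) : IsBlockLowerUnipotent b (r * s) :=
  (isBlockLowerUnipotent_iff _).mpr
    (((isBlockLowerUnipotent_iff _).mp hr).mul ((isBlockLowerUnipotent_iff _).mp hs))

/-- The subgroup of `GL n k` of block upper unipotent matrices for the weight function `b`.
[folklore] -/
def blockUpperUnipotentGL (b : n → α) : Subgroup (GL n k) where
  carrier := {g | IsBlockUpperUnipotent b (g : Matrix n n k)}
  one_mem' := ⟨Matrix.blockTriangular_one, fun _ _ _ => rfl⟩
  mul_mem' hg hh := by
    simp only [Set.mem_setOf_eq, Units.val_mul] at *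
    exact hg.mul hh
  inv_mem' hg := by
    simp only [Set.mem_setOf_eq, Matrix.coe_units_inv] at *
    exact hg.inv

/-- The subgroup of `GL n k` of block lower unipotent matrices for the weight function `b`.
[folklore] -/
def blockLowerUnipotentGL (b : n → α) : Subgroup (GL n k) where
  carrier := {g | IsBlockLowerUnipotent b (g : Matrix n n k)}
  one_mem' := ⟨Matrix.blockTriangular_one, fun _ _ _ => rfl⟩
  mul_mem' hg hh := by
    simp only [Set.mem_setOf_eq, Units.val_mul] at *
    exact hg.mul hh
  inv_mem' hg := by
    simp only [Set.mem_setOf_eq, Matrix.coe_units_inv] at *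
    exact hg.inv

variable {k}

/-- Membership in `blockUpperUnipotentGL`. [folklore] -/
@[simp] theorem mem_blockUpperUnipotentGL {b : n → α} {g : GL n k} :
    g ∈ blockUpperUnipotentGL k b ↔ IsBlockUpperUnipotent b (g : Matrix n n k) := Iff.rfl

/-- Membership in `blockLowerUnipotentGL`. [folklore] -/
@[simp] theorem mem_blockLowerUnipotentGL {b : n → α} {g : GL n k} :
    g ∈ blockLowerUnipotentGL k b ↔ IsBlockLowerUnipotent b (g : Matrix n n k) := Iff.rfl

end BlockGroups

/-! ### Weights: a one-parameter group normalised by a diagonal cocharacter is block unipotent -/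

section Weights

variable {k : Type*} [Field k]

/-- **Homogeneity kills coefficients.** Let `p ∈ k[X]` over an infinite field satisfy
`p(c^h x) = c^e p(x)` for all `c ∈ kˣ`, `x ∈ k`. If `e ∉ {h d | d ≥ 1}` then `p` is constant:
comparing coefficients of `X^d` gives `c^{hd} p_d = c^e p_d`, and the characters `c ↦ c^m` of
`kˣ` are pairwise distinct (`zpowGroupHom_units_injective`). [folklore] -/
theorem _root_.Polynomial.eq_C_of_eval_zpow_mul [Infinite k] (p : k[X]) (h e : ℤ)
    (hp : ∀ (c : kˣ) (x : k), p.eval (((c ^ h : kˣ) : k) * x) = ((c ^ e : kˣ) : k) * p.eval x)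
    (hne : ∀ d : ℕ, 0 < d → h * d ≠ e) : p = C (p.coeff 0) := by
  ext d
  rcases d with _ | d
  · simp
  rw [coeff_C, if_neg (Nat.succ_ne_zero d)]
  by_contra hd
  apply hne (d + 1) (Nat.succ_pos d)
  apply zpowGroupHom_units_injective (k := k)
  ext c
  -- polynomial identity `p (a X) = b p` for `a = c^h`, `b = c^e`
  have hpoly : p.comp (C ((c ^ h : kˣ) : k) * X) = C ((c ^ e : kˣ) : k) * p :=
    Polynomial.funext fun x => by
      rw [eval_comp, eval_mul, eval_C, eval_X, eval_mul, eval_C]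
      exact hp c x
  have hcoeff := congrArg (fun q => q.coeff (d + 1)) hpoly
  simp only [comp_C_mul_X_coeff, coeff_C_mul] at hcoeff
  -- cancel `p.coeff (d+1) ≠ 0`
  have h1 : ((c ^ h : kˣ) : k) ^ (d + 1) = ((c ^ e : kˣ) : k) :=
    mul_left_cancel₀ hd (hcoeff.trans (mul_comm _ _))
  simp only [zpowGroupHom_apply]
  rw [Units.val_zpow_eq_zpow_val, Units.val_zpow_eq_zpow_val, zpow_mul, zpow_natCast]
  rw [Units.val_zpow_eq_zpow_val, Units.val_zpow_eq_zpow_val] at h1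
  exact_mod_cast h1

variable {n : Type*} [Fintype n] [DecidableEq n]

omit [Fintype n] in
/-- **Weights of a one-parameter family under a diagonal torus.** Let `M : k → Matₙ(k)` have
polynomial entries and `M(0) = 1`, and suppose `diag(c^{m}) · M(x) · diag(c^{-m}) = M(c^h x)`
for all `c ∈ kˣ` (conjugation by the cocharacter `c ↦ diag(c^{m_1}, …, c^{m_n})` rescales the
parameter by the character `c ↦ c^h`). Then the entry `M(x)_{ij}` is `δ_{ij}` unless
`m_i - m_j = h d` for some `d ≥ 1` (Springer 8.1.1, 8.2.2: `Im u_α` has the single weight `α`;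
here in coordinates). [folklore] -/
theorem apply_eq_one_apply_of_diagonal_conj [Infinite k] {M : k → Matrix n n k}
    (P : n → n → k[X]) (hP : ∀ x i j, M x i j = (P i j).eval x) (h0 : M 0 = 1) (m : n → ℤ)
    (h : ℤ) (hconj : ∀ (c : kˣ) (x : k) (i j : n),
      ((c ^ m i : kˣ) : k) * M x i j * ((c ^ (-m j) : kˣ) : k) = M (((c ^ h : kˣ) : k) * x) i j)
    {i j : n} (hij : ∀ d : ℕ, 0 < d → h * d ≠ m i - m j) (x : k) :
    M x i j = (1 : Matrix n n k) i j := by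
  have key : P i j = C ((P i j).coeff 0) := by
    refine (P i j).eq_C_of_eval_zpow_mul h (m i - m j) (fun c y => ?_) hij
    rw [← hP, ← hP, ← hconj c y i j, mul_comm (((c ^ m i : kˣ) : k)) (M y i j), mul_assoc,
      ← Units.val_mul, ← zpow_add, mul_comm, ← sub_eq_add_neg]
  have e1 : ∀ y, M y i j = (P i j).coeff 0 := fun y => by
    rw [hP]
    conv_lhs => rw [key]
    rw [eval_C]
  rw [e1 x, ← e1 0, h0]

omit [Fintype n] in
/-- In the situation of `apply_eq_one_apply_of_diagonal_conj`, if `h > 0` then `M(x)` is block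
upper unipotent for the weight function `-m`. [folklore] -/
theorem isBlockUpperUnipotent_of_diagonal_conj [Infinite k] {M : k → Matrix n n k}
    (P : n → n → k[X]) (hP : ∀ x i j, M x i j = (P i j).eval x) (h0 : M 0 = 1) (m : n → ℤ)
    (h : ℤ) (hh : 0 < h) (hconj : ∀ (c : kˣ) (x : k) (i j : n),
      ((c ^ m i : kˣ) : k) * M x i j * ((c ^ (-m j) : kˣ) : k) = M (((c ^ h : kˣ) : k) * x) i j)
    (x : k) : IsBlockUpperUnipotent (fun i => -m i) (M x) := by
  have aux : ∀ i j, m i ≤ m j → M x i j = (1 : Matrix n n k) i j := fun i j hle =>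
    apply_eq_one_apply_of_diagonal_conj P hP h0 m h hconj (fun d hd heq => by
      have : 0 < h * d := mul_pos hh (by exact_mod_cast hd)
      omega) x
  refine ⟨fun i j hlt => ?_, fun i j heq => aux i j (by simpa using heq.ge)⟩
  have hle : m i ≤ m j := by simpa using (neg_lt_neg_iff.mp hlt).le
  rw [aux i j hle, Matrix.one_apply_ne]
  rintro rfl
  exact lt_irrefl _ hlt

omit [Fintype n] in
/-- In the situation of `apply_eq_one_apply_of_diagonal_conj`, if `h < 0` then `M(x)` is block
lower unipotent for the weight function `-m`. [folklore] -/
theorem isBlockLowerUnipotent_of_diagonal_conj [Infinite k] {M : k → Matrix n n k}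
    (P : n → n → k[X]) (hP : ∀ x i j, M x i j = (P i j).eval x) (h0 : M 0 = 1) (m : n → ℤ)
    (h : ℤ) (hh : h < 0) (hconj : ∀ (c : kˣ) (x : k) (i j : n),
      ((c ^ m i : kˣ) : k) * M x i j * ((c ^ (-m j) : kˣ) : k) = M (((c ^ h : kˣ) : k) * x) i j)
    (x : k) : IsBlockLowerUnipotent (fun i => -m i) (M x) := by
  have aux : ∀ i j, m j ≤ m i → M x i j = (1 : Matrix n n k) i j := fun i j hle =>
    apply_eq_one_apply_of_diagonal_conj P hP h0 m h hconj (fun d hd heq => by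
      have : h * d < 0 := mul_neg_of_neg_of_pos hh (by exact_mod_cast hd)
      omega) x
  refine ⟨fun i j hlt => ?_, fun i j heq => aux i j (by simpa using heq.le)⟩
  have hlt' : -m i < -m j := OrderDual.toDual_lt_toDual.mp hlt
  have hle : m j ≤ m i := by simpa using (neg_lt_neg_iff.mp hlt').le
  rw [aux i j hle, Matrix.one_apply_ne]
  rintro rfl
  exact lt_irrefl _ hlt'

end Weights

/-! ### Root homomorphisms conjugated by a matrix diagonalising the torus -/

section RootHomWeights

variable {k : Type*} [Field k] {n : Type*} [Fintype n] [DecidableEq n]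
variable {G T : Subgroup (GL n k)} [IsMulCommutative ↥T]

/-- The **weights** `m_j ∈ ℤ` of an algebraic cocharacter `λ : 𝔾ₘ → T` in a basis diagonalising
`T`: if `A T A⁻¹ ≤ 𝔻ₙ` then `A λ(c) A⁻¹ = diag(c^{m_1}, …, c^{m_n})` (`conj_cochar_eq_diagonal`;
Springer 3.2.2–3.2.3: the characters of `𝔻ₙ` are the monomials). [folklore] -/
def cocharWeight (A : GL n k) (hA : T.map (MulAut.conj A).toMonoidHom ≤ diagonalSubgroup n k)
    (γ : kˣ →* ↥T) (j : n) : ℤ :=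
  charPairingInt (diagEntryChar hA j) ((conjEquiv A T).toMonoidHom.comp γ)

omit [IsMulCommutative ↥T] in
/-- `A λ(c) A⁻¹` is the diagonal matrix `diag(c^{m_j})`, `m = cocharWeight A hA λ`
(Springer 3.2.11 (i): `χ_j (λ (c)) = c^{⟨χ_j, λ⟩}` for the coordinate characters `χ_j` of
`𝔻ₙ`). [folklore] -/
theorem conj_cochar_eq_diagonal [Infinite k] (A : GL n k)
    (hA : T.map (MulAut.conj A).toMonoidHom ≤ diagonalSubgroup n k) {γ : kˣ →* ↥T}
    (hγ : IsAlgebraicCochar γ) (c : kˣ) :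
    ((A * (γ c : ↥T) * A⁻¹ : GL n k) : Matrix n n k) =
      Matrix.diagonal fun j => ((c ^ cocharWeight A hA γ j : kˣ) : k) := by
  have hγ' : IsAlgebraicCochar ((conjEquiv A T).toMonoidHom.comp γ) := hγ.conjEquiv_comp A
  have hmem := coe_conjEquiv_apply A (T := T) (γ c)
  rw [← hmem]
  ext i j
  rw [coe_apply_diagCoord hA, Matrix.diagonal_apply]
  split_ifs with hij
  · subst hij
    rw [← diagEntryChar_apply, cocharWeight,
      ← charPairingInt_spec_holds (isAlgebraicChar_diagEntryChar hA i) hγ' c]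
    rfl
  · rfl

variable {hTG : T ≤ G} {α : ↥T →* kˣ} {u : Multiplicative k →* ↥G}

/-- The entries of `A u(x) A⁻¹` are polynomials in `x`, for an algebraic `u : 𝔾ₐ → G`.
[folklore] -/
theorem IsAlgebraicAddHom.exists_polynomial_conj (hu : IsAlgebraicAddHom u) (A : GL n k) :
    ∃ P : n → n → k[X], ∀ (x : k) (i j : n),
      ((A * ((u (Multiplicative.ofAdd x) : ↥G) : GL n k) * A⁻¹ : GL n k) : Matrix n n k) i j =
        (P i j).eval x := by
  obtain ⟨Pu, hPu⟩ := hu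
  refine ⟨fun i j => ∑ q : n, ∑ p : n, C ((A : Matrix n n k) i p) * Pu (Sum.inl (p, q)) *
    C (((A⁻¹ : GL n k) : Matrix n n k) q j), fun x i j => ?_⟩
  have hU : ∀ p q, (((u (Multiplicative.ofAdd x) : ↥G) : GL n k) : Matrix n n k) p q =
      (Pu (Sum.inl (p, q))).eval x := fun p q => by
    rw [← hPu x (Sum.inl (p, q)), glCoordFun_inl]
  simp only [Units.val_mul, Matrix.mul_apply, eval_finsetSum, eval_mul, eval_C, Finset.sum_mul, hU]

omit [IsMulCommutative ↥T] in
/-- The torus relation of a root homomorphism along a cocharacter: `λ(c) u(x) λ(c)⁻¹ =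
u(c^{⟨α, λ⟩} x)` (Springer 8.1.1 (i) with 3.2.11 (i)). [folklore] -/
theorem IsRootHom.cochar_conj [Infinite k] (hu : IsRootHom G T hTG α u) (hα : IsAlgebraicChar α)
    {γ : kˣ →* ↥T} (hγ : IsAlgebraicCochar γ) (c : kˣ) (x : k) :
    ((γ c : ↥T) : GL n k) * ((u (Multiplicative.ofAdd x) : ↥G) : GL n k) * ((γ c : ↥T) : GL n k)⁻¹ =
      ((u (Multiplicative.ofAdd (((c ^ charPairingInt α γ : kˣ) : k) * x)) : ↥G) : GL n k) := by
  have h := congrArg (fun g : ↥G => (g : GL n k)) (hu.2.2 (γ c) x)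
  simp only [Subgroup.coe_mul, Subgroup.coe_inv] at h
  rw [charPairingInt_spec_holds hα hγ c] at h
  exact h

/-- Conjugating the torus relation `λ(c) u(y) λ(c)⁻¹ = u(c^h y)` by a matrix `A` diagonalising
`T`: `c^{m_i} · (A u(y) A⁻¹)_{ij} · c^{-m_j} = (A u(c^h y) A⁻¹)_{ij}`. [folklore] -/
theorem conj_entry_identity [Infinite k] (hu : IsRootHom G T hTG α u) (hα : IsAlgebraicChar α)
    {γ : kˣ →* ↥T} (hγ : IsAlgebraicCochar γ) (A : GL n k)
    (hA : T.map (MulAut.conj A).toMonoidHom ≤ diagonalSubgroup n k) (c : kˣ) (y : k) (i j : n) :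
    ((c ^ cocharWeight A hA γ i : kˣ) : k) *
        ((A * ((u (Multiplicative.ofAdd y) : ↥G) : GL n k) * A⁻¹ : GL n k) : Matrix n n k) i j *
        ((c ^ (-cocharWeight A hA γ j) : kˣ) : k) =
      ((A * ((u (Multiplicative.ofAdd (((c ^ charPairingInt α γ : kˣ) : k) * y)) : ↥G) : GL n k) *
        A⁻¹ : GL n k) : Matrix n n k) i j := by
  -- the relation in `GL n k`, conjugated by `A`
  have key : (A * ((γ c : ↥T) : GL n k) * A⁻¹) *
      (A * ((u (Multiplicative.ofAdd y) : ↥G) : GL n k) * A⁻¹) *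
      (A * ((γ c⁻¹ : ↥T) : GL n k) * A⁻¹) =
        A * ((u (Multiplicative.ofAdd (((c ^ charPairingInt α γ : kˣ) : k) * y)) : ↥G) : GL n k) *
          A⁻¹ := by
    rw [← hu.cochar_conj hα hγ c y, map_inv, Subgroup.coe_inv]
    group
  have kmat : ((A * ((γ c : ↥T) : GL n k) * A⁻¹ : GL n k) : Matrix n n k) *
      ((A * ((u (Multiplicative.ofAdd y) : ↥G) : GL n k) * A⁻¹ : GL n k) : Matrix n n k) *
      ((A * ((γ c⁻¹ : ↥T) : GL n k) * A⁻¹ : GL n k) : Matrix n n k) =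
        ((A * ((u (Multiplicative.ofAdd (((c ^ charPairingInt α γ : kˣ) : k) * y)) : ↥G) :
          GL n k) * A⁻¹ : GL n k) : Matrix n n k) := by
    rw [← Units.val_mul, ← Units.val_mul, key]
  rw [conj_cochar_eq_diagonal A hA hγ c, conj_cochar_eq_diagonal A hA hγ c⁻¹] at kmat
  have kij := congr_fun (congr_fun kmat i) j
  rw [Matrix.mul_diagonal, Matrix.diagonal_mul] at kij
  rw [← kij, inv_zpow']

/-- **Positive root homomorphisms become block upper unipotent.** Let `A` diagonalise `T`, let
`λ` be an algebraic cocharacter of `T` with weights `m` and `u` a root homomorphism for the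
algebraic character `α` with `⟨α, λ⟩ > 0`. Then every `A u(x) A⁻¹` is block upper unipotent for
the weight function `-m` (Springer 8.2.1–8.2.2 in coordinates: `U_α ⊂ U(λ)`, cf. 13.4.2
(i)/8.4.5 for the groups `P(λ) ⊃ U(λ)`). [folklore] -/
theorem IsRootHom.isBlockUpperUnipotent_conj [Infinite k] (hu : IsRootHom G T hTG α u)
    (hα : IsAlgebraicChar α) {γ : kˣ →* ↥T} (hγ : IsAlgebraicCochar γ) (A : GL n k)
    (hA : T.map (MulAut.conj A).toMonoidHom ≤ diagonalSubgroup n k)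
    (hpos : 0 < charPairingInt α γ) (x : k) :
    IsBlockUpperUnipotent (fun j => -cocharWeight A hA γ j)
      ((A * ((u (Multiplicative.ofAdd x) : ↥G) : GL n k) * A⁻¹ : GL n k) : Matrix n n k) := by
  obtain ⟨P, hP⟩ := hu.1.exists_polynomial_conj A
  set M : k → Matrix n n k := fun x =>
    ((A * ((u (Multiplicative.ofAdd x) : ↥G) : GL n k) * A⁻¹ : GL n k) : Matrix n n k) with hM
  have h0 : M 0 = 1 := by
    simp only [hM, ofAdd_zero, map_one, OneMemClass.coe_one, mul_one, mul_inv_cancel, Units.val_one]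
  refine isBlockUpperUnipotent_of_diagonal_conj (M := M) P hP h0 (cocharWeight A hA γ)
    (charPairingInt α γ) hpos (fun c y i j => ?_) x
  exact conj_entry_identity hu hα hγ A hA c y i j

/-- **Negative root homomorphisms become block lower unipotent**: as
`IsRootHom.isBlockUpperUnipotent_conj`, for `⟨α, λ⟩ < 0`. [folklore] -/
theorem IsRootHom.isBlockLowerUnipotent_conj [Infinite k] (hu : IsRootHom G T hTG α u)
    (hα : IsAlgebraicChar α) {γ : kˣ →* ↥T} (hγ : IsAlgebraicCochar γ) (A : GL n k)
    (hA : T.map (MulAut.conj A).toMonoidHom ≤ diagonalSubgroup n k)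
    (hneg : charPairingInt α γ < 0) (x : k) :
    IsBlockLowerUnipotent (fun j => -cocharWeight A hA γ j)
      ((A * ((u (Multiplicative.ofAdd x) : ↥G) : GL n k) * A⁻¹ : GL n k) : Matrix n n k) := by
  obtain ⟨P, hP⟩ := hu.1.exists_polynomial_conj A
  set M : k → Matrix n n k := fun x =>
    ((A * ((u (Multiplicative.ofAdd x) : ↥G) : GL n k) * A⁻¹ : GL n k) : Matrix n n k) with hM
  have h0 : M 0 = 1 := by
    simp only [hM, ofAdd_zero, map_one, OneMemClass.coe_one, mul_one, mul_inv_cancel, Units.val_one]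
  refine isBlockLowerUnipotent_of_diagonal_conj (M := M) P hP h0 (cocharWeight A hA γ)
    (charPairingInt α γ) hneg (fun c y i j => ?_) x
  exact conj_entry_identity hu hα hγ A hA c y i j

end RootHomWeights

/-! ### Regular functions composed with a fixed conjugation -/

section Conj

variable {k : Type*} [Field k] {n : Type*} [Fintype n] [DecidableEq n]

/-- A function regular on `{d ≠ 0} ⊆ GL n k` composed with `g ↦ A g B` is regular on the
pulled-back principal open set. [folklore] -/
theorem IsRegularOnGL.comp_conj (A B : GL n k) {d : MvPolynomial (GLCoord n) k} {c : GL n k → k}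
    (hc : IsRegularOnGL Set.univ d c) :
    IsRegularOnGL Set.univ (MvPolynomial.bind₁ (conjPolyGL A B) d) fun g => c (A * g * B) := by
  obtain ⟨p, N, hp⟩ := hc
  refine ⟨MvPolynomial.bind₁ (conjPolyGL A B) p, N, fun g _ hd => ?_⟩
  have e : (fun i => MvPolynomial.eval (glCoordFun g) (conjPolyGL A B i)) =
      glCoordFun (A * g * B) :=
    funext (eval_conjPolyGL A B g)
  rw [eval_bind₁, e] at hd ⊢
  rw [eval_bind₁, e]
  exact hp _ (Set.mem_univ _) hd

/-- Evaluating `bind₁ (conjPolyGL A B) d` at `g` is evaluating `d` at `A g B`. [folklore] -/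
theorem eval_bind₁_conjPolyGL (A B g : GL n k) (d : MvPolynomial (GLCoord n) k) :
    MvPolynomial.eval (glCoordFun g) (MvPolynomial.bind₁ (conjPolyGL A B) d) =
      MvPolynomial.eval (glCoordFun (A * g * B)) d := by
  rw [eval_bind₁]
  exact congrArg (fun f => MvPolynomial.eval f d) (funext (eval_conjPolyGL A B g))

/-- Conjugating a matrix-valued function with regular entries by constant matrices gives a
function with regular entries. [folklore] -/
theorem IsRegularOnGL.const_mul_mul_const {Z : Set (GL n k)} {d : MvPolynomial (GLCoord n) k}
    (A B : Matrix n n k) {M : GL n k → Matrix n n k}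
    (hM : ∀ i j, IsRegularOnGL Z d fun g => M g i j) (i j : n) :
    IsRegularOnGL Z d fun g => (A * M g * B) i j :=
  IsRegularOnGL.matrix_mul (M := fun g => A * M g) (N := fun _ => B)
    (IsRegularOnGL.matrix_mul (M := fun _ => A) (N := M) (fun i j => IsRegularOnGL.const (A i j))
      hM) (fun i j => IsRegularOnGL.const (B i j)) i j

/-- The coordinate function of a matrix: entries, and `det⁻¹` in the last slot; for `g ∈ GL n k`
this is `glCoordFun g`. [folklore] -/
def matCoordFun (M : Matrix n n k) : GLCoord n → k :=
  Sum.elim (fun ij => M ij.1 ij.2) fun _ => (M.det)⁻¹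

/-- `matCoordFun ↑g = glCoordFun g`. [folklore] -/
@[simp] theorem matCoordFun_coe (g : GL n k) : matCoordFun (g : Matrix n n k) = glCoordFun g := by
  funext c; rcases c with ⟨i, j⟩ | u <;> rfl

end Conj

/-! ### The two structure-theory inputs: Springer 8.2.1 and 8.3.11 -/

section Facts

variable {k : Type*} [Field k] {n : Type*} [Fintype n] [DecidableEq n]
variable {ι X Y : Type*} [AddCommGroup X] [AddCommGroup Y]
variable (G T : Subgroup (GL n k))

/-- The subgroup `U(y) = ⟨u_i(𝔾ₐ) : ⟨α_i, y⟩ > 0⟩ ≤ GL n k` generated by the images of the root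
homomorphisms `u_i` of the `y`-positive roots. For `G` connected reductive with maximal torus
`T`, root datum `P` and `y ∈ X_*(T)` regular (no root vanishes on `y`), `R⁺(y) = {α | ⟨α, y⟩ > 0}`
is a system of positive roots (Springer 7.4.5), `u_i(𝔾ₐ) = U_{α_i}` (8.1.1 (i)) and `U(y)` is
the unipotent radical `B(y)_u` of the Borel subgroup `B(y) = T · U(y) ⊇ T` with
`R⁺(B(y)) = R⁺(y)` (8.2.4 (i) with 8.2.1). [cite: SpringerLAG1998, 8.2.1 and 8.2.4 (i)] -/
def posRootGroup (P : RootPairing ι ℤ X Y) (u : ι → Multiplicative k →* ↥G) (y : Y) :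
    Subgroup (GL n k) :=
  ⨆ i : {i : ι // 0 < P.root' i y}, (u i.1).range.map G.subtype

variable {G} in
/-- `u_i(x) ∈ U(y)` for a `y`-positive root `α_i`. [folklore] -/
theorem apply_mem_posRootGroup {P : RootPairing ι ℤ X Y} (u : ι → Multiplicative k →* ↥G)
    {y : Y} {i : ι} (hi : 0 < P.root' i y) (x : Multiplicative k) :
    ((u i x : ↥G) : GL n k) ∈ posRootGroup G P u y := by
  refine Subgroup.mem_iSup_of_mem (S := fun i : {i : ι // 0 < P.root' i y} =>
    (u i.1).range.map G.subtype) ⟨i, hi⟩ ?_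
  exact ⟨u i x, ⟨x, rfl⟩, rfl⟩

variable [IsMulCommutative ↥T]

/-- **Springer 8.2.1 (the unipotent radical of a Borel subgroup is the product of its root
subgroups), as a named fact.** Let `G` be connected reductive over an algebraically closed field
of characteristic `0` (Springer: any characteristic; the extra hypothesis only weakens the fact),
`T` a maximal torus with root datum `P`, `u_i` root homomorphisms of all roots, `y ∈ X_*(T)`
regular and `(α_i)_{i ∈ l}` a numbering of the positive system `R⁺(y) = {α | ⟨α, y⟩ > 0}`
(7.4.5). Then *the morphism `φ : 𝔾ₐ^m → B(y)_u`, `φ(x) = u_{α_1}(x_1) ⋯ u_{α_m}(x_m)` is an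
isomorphism of varieties; in particular `B(y)_u` is generated by the `U_α`, `α ∈ R⁺(y)`*
(8.2.1, for the Borel subgroup `B(y) ⊇ T` of the positive system `R⁺(y)`, 8.2.4 (i); with
`U_{α_i} = u_i(𝔾ₐ)`, 8.1.1 (i)). Recorded as: `φ` maps onto `U(y) = ⟨u_i(𝔾ₐ) : i ∈ l⟩`
(`posRootGroup`) and has a polynomial left inverse — there are polynomials `q_i` in the matrix
coordinates with `q_i(φ(x)) = x_i` (the inverse isomorphism `B(y)_u → 𝔾ₐ^m` composed with the
coordinate projections is a regular function on the closed subvariety `B(y)_u ⊆ G ⊆ GL_n`, hence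
the restriction of a polynomial, 1.4.6 with 1.3).
[cite: SpringerLAG1998, 8.2.1 with 8.2.4 (i) and 8.1.1 (i)] -/
def posRootGroup_prodIso : Prop :=
  ∀ [IsAlgClosed k] [CharZero k] (_hG : IsConnectedReductive G) (_hT : IsMaximalTorusIn T G)
    {P : RootPairing ι ℤ X Y} {eX : Additive ↥(characterLattice T) ≃+ X}
    {eY : Additive ↥(cocharacterLattice T) ≃+ Y} (h : IsRootDatumOf G T P eX eY)
    (u : ι → Multiplicative k →* ↥G)
    (_hu : ∀ i, IsRootHom G T h.le (charOfWeight eX (P.root i)) (u i))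
    (y : Y) (_hy : ∀ i, P.root' i y ≠ 0) (l : List ι) (_hl : l.Nodup)
    (_hl' : ∀ i, i ∈ l ↔ 0 < P.root' i y),
    (∀ g ∈ posRootGroup G P u y, ∃ x : ι → k,
        g = (l.map fun i => ((u i (Multiplicative.ofAdd (x i)) : ↥G) : GL n k)).prod) ∧
      ∃ q : ι → MvPolynomial (GLCoord n) k, ∀ (x : ι → k), ∀ i ∈ l,
        MvPolynomial.eval (glCoordFun
          (l.map fun i => ((u i (Multiplicative.ofAdd (x i)) : ↥G) : GL n k)).prod) (q i) = x i

/-- **Springer 8.3.11 (the big cell is open), as a named fact, in the translated form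
`Ω = U⁻ T U ∋ 1`.** Let `G` be connected reductive over an algebraically closed field of
characteristic `0` (Springer: any characteristic), `T` a maximal torus with root datum `P`, `u_i`
root homomorphisms of all roots and `y ∈ X_*(T)` regular, with positive system `R⁺ = R⁺(y)`,
Borel subgroup `B = T · U`, `U = U(y)`, and `U⁻ = U(-y)` (`posRootGroup`; 8.2.1, 8.2.4 (i),
8.1.1 (i)). By 8.3.6 (ii) (for `w = w₀`, `U_{w₀} = U`) and 8.3.11, `C(w₀) = U ẇ₀ B` is open in
`G`; translating by `ẇ₀⁻¹` and using `ẇ₀⁻¹ U ẇ₀ = U(w₀⁻¹ R⁺) = U(-R⁺) = U⁻` (8.1.12 (2) with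
8.2.4 (ii): `w₀ R⁺ = -R⁺`), the *big cell* `Ω = U⁻ B = U⁻ T U` is an open subset of `G`
containing `1`. Recorded through its consequence: `Ω` contains an open neighbourhood of `1` in
`G ⊆ GL_n` of the form `G ∩ ⋃_{e ∈ E} {e ≠ 0}`, `E` a finite set of polynomials in the matrix
coordinates (principal open sets form a basis of the Zariski topology, 1.3.5/1.4.6) — every
`g ∈ G` with `e(g) ≠ 0` for some `e ∈ E` factors as `g = v t w`, `v ∈ U⁻`, `t ∈ T`, `w ∈ U`.
[cite: SpringerLAG1998, 8.3.11 with 8.3.6 (ii)] -/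
def bigCell_nhds_one : Prop :=
  ∀ [IsAlgClosed k] [CharZero k] (_hG : IsConnectedReductive G) (_hT : IsMaximalTorusIn T G)
    {P : RootPairing ι ℤ X Y} {eX : Additive ↥(characterLattice T) ≃+ X}
    {eY : Additive ↥(cocharacterLattice T) ≃+ Y} (h : IsRootDatumOf G T P eX eY)
    (u : ι → Multiplicative k →* ↥G)
    (_hu : ∀ i, IsRootHom G T h.le (charOfWeight eX (P.root i)) (u i))
    (y : Y) (_hy : ∀ i, P.root' i y ≠ 0),
    ∃ E : Finset (MvPolynomial (GLCoord n) k),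
      (∃ e ∈ E, MvPolynomial.eval (glCoordFun (1 : GL n k)) e ≠ 0) ∧
        ∀ g ∈ G, (∃ e ∈ E, MvPolynomial.eval (glCoordFun g) e ≠ 0) →
          ∃ v ∈ posRootGroup G P u (-y), ∃ t ∈ T, ∃ w ∈ posRootGroup G P u y, g = v * t * w

end Facts

/-! ### The big cell chart from the Gauss decomposition -/

section Assembly

variable {k : Type*} [Field k] {n : Type*} [Fintype n] [DecidableEq n]
variable {ι : Type*} {G T : Subgroup (GL n k)}

/-- **The inverse chart of the big cell from the Gauss decomposition in `GL_n`.** Suppose a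
fixed matrix `A` conjugates the subgroup `U⁻` into the block lower unipotent matrices, `T` into
the block diagonal matrices and `U⁺` into the block upper unipotent matrices of `GL_n` (for some
weight function `b`), that `U^∓` are parametrised by ordered products of the one-parameter
groups `u_i`, `i ∈ L_∓`, with polynomial left inverses `q^∓_i`, and that every `g` in the open
neighbourhood `G ∩ ⋃_{e ∈ E} {e ≠ 0}` of `1` factors as `g = v t w ∈ U⁻ T U⁺`. Then the factors
are the Gauss factors of `A g A⁻¹` conjugated back (`gauss_unique`), hence regular functions of
`g`, and one obtains a `BigCellChart G T u`. [folklore] -/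
theorem nonempty_bigCellChart_of_gauss {α : Type*} [LinearOrder α] (b : n → α) (A : GL n k)
    (u : ι → Multiplicative k →* ↥G) (Lneg Lpos : List ι) (Uneg Upos : Subgroup (GL n k))
    (hUneg : ∀ v ∈ Uneg, IsBlockLowerUnipotent b ((A * v * A⁻¹ : GL n k) : Matrix n n k))
    (hUpos : ∀ w ∈ Upos, IsBlockUpperUnipotent b ((A * w * A⁻¹ : GL n k) : Matrix n n k))
    (hTd : ∀ t ∈ T, IsBlockDiagonalFor b ((A * t * A⁻¹ : GL n k) : Matrix n n k))
    (qneg qpos : ι → MvPolynomial (GLCoord n) k)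
    (hsurj_neg : ∀ v ∈ Uneg, ∃ x : ι → k,
      v = (Lneg.map fun i => ((u i (Multiplicative.ofAdd (x i)) : ↥G) : GL n k)).prod)
    (hq_neg : ∀ (x : ι → k), ∀ i ∈ Lneg, MvPolynomial.eval (glCoordFun
      (Lneg.map fun i => ((u i (Multiplicative.ofAdd (x i)) : ↥G) : GL n k)).prod) (qneg i) = x i)
    (hsurj_pos : ∀ w ∈ Upos, ∃ x : ι → k,
      w = (Lpos.map fun i => ((u i (Multiplicative.ofAdd (x i)) : ↥G) : GL n k)).prod)
    (hq_pos : ∀ (x : ι → k), ∀ i ∈ Lpos, MvPolynomial.eval (glCoordFun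
      (Lpos.map fun i => ((u i (Multiplicative.ofAdd (x i)) : ↥G) : GL n k)).prod) (qpos i) = x i)
    (E : Finset (MvPolynomial (GLCoord n) k))
    (h1E : ∃ e ∈ E, MvPolynomial.eval (glCoordFun (1 : GL n k)) e ≠ 0)
    (hΩ : ∀ g ∈ G, (∃ e ∈ E, MvPolynomial.eval (glCoordFun g) e ≠ 0) →
      ∃ v ∈ Uneg, ∃ t ∈ T, ∃ w ∈ Upos, g = v * t * w) :
    Nonempty (BigCellChart G T u) := by
  classical
  -- the conjugated Gauss factors
  set cj : GL n k → Matrix n n k := fun g => ((A * g * A⁻¹ : GL n k) : Matrix n n k) with hcj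
  set Lf : GL n k → Matrix n n k := fun g =>
    ((A⁻¹ : GL n k) : Matrix n n k) * gaussL b (cj g) * (A : Matrix n n k) with hLf
  set Uf : GL n k → Matrix n n k := fun g =>
    ((A⁻¹ : GL n k) : Matrix n n k) * gaussU b (cj g) * (A : Matrix n n k) with hUf
  set Df : GL n k → Matrix n n k := fun g =>
    ((A⁻¹ : GL n k) : Matrix n n k) * gaussD b (cj g) * (A : Matrix n n k) with hDf
  set dA : MvPolynomial (GLCoord n) k := MvPolynomial.bind₁ (conjPolyGL A A⁻¹) (gaussDenom b)
    with hdA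
  set xc : ι → GL n k → k := fun i g => MvPolynomial.eval (matCoordFun (Lf g)) (qneg i) with hxc
  set yc : ι → GL n k → k := fun i g => MvPolynomial.eval (matCoordFun (Uf g)) (qpos i) with hyc
  set tc : GL n k → GL n k := fun g =>
    if h : ∃ t : ↥T, ((t : GL n k) : Matrix n n k) = Df g then (h.choose : GL n k) else 1 with htc
  have htc_mem : ∀ g, tc g ∈ T := by
    intro g
    simp only [htc]
    split_ifs with h
    · exact h.choose.2
    · exact T.one_mem
  have hdA_eval : ∀ g : GL n k, MvPolynomial.eval (glCoordFun g) dA =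
      MvPolynomial.eval (glCoordFun (A * g * A⁻¹)) (gaussDenom b) := fun g =>
    eval_bind₁_conjPolyGL A A⁻¹ g _
  -- **core**: on `Ω`, the Gauss factors of `A g A⁻¹` are the conjugates of `v, t, w`
  have core : ∀ g ∈ G, (∃ e ∈ E, MvPolynomial.eval (glCoordFun g) e ≠ 0) →
      (∀ a, leadMinor b (cj g) a ≠ 0) ∧ ((tc g : GL n k) : Matrix n n k) = Df g ∧
      g = (Lneg.map fun i => ((u i (Multiplicative.ofAdd (xc i g)) : ↥G) : GL n k)).prod * tc g *
        (Lpos.map fun i => ((u i (Multiplicative.ofAdd (yc i g)) : ↥G) : GL n k)).prod := by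
    intro g hg hE
    obtain ⟨v, hv, t, ht, w, hw, hgvtw⟩ := hΩ g hg hE
    have hdec : cj g = ((A * v * A⁻¹ : GL n k) : Matrix n n k) *
        ((A * t * A⁻¹ : GL n k) : Matrix n n k) * ((A * w * A⁻¹ : GL n k) : Matrix n n k) := by
      simp only [hcj, ← Units.val_mul]
      congr 1
      rw [hgvtw]; group
    have htdet : ((A * t * A⁻¹ : GL n k) : Matrix n n k).det ≠ 0 :=
      (Matrix.isUnit_iff_isUnit_det _ |>.mp (Units.isUnit _)).ne_zero
    obtain ⟨hΔ, hL, hD, hU⟩ := gauss_unique (hUneg v hv) (hTd t ht) htdet (hUpos w hw) hdec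
    -- conjugating back
    have hback : ∀ x : GL n k, ((A⁻¹ : GL n k) : Matrix n n k) *
        ((A * x * A⁻¹ : GL n k) : Matrix n n k) * (A : Matrix n n k) = (x : Matrix n n k) :=
        fun x => by
      rw [← Units.val_mul, ← Units.val_mul]
      congr 1; group
    have hLf_eq : Lf g = (v : Matrix n n k) := by simp only [hLf]; rw [← hL, hback]
    have hUf_eq : Uf g = (w : Matrix n n k) := by simp only [hUf]; rw [← hU, hback]
    have hDf_eq : Df g = (t : Matrix n n k) := by simp only [hDf]; rw [← hD, hback]
    -- the torus factor
    have hex : ∃ t' : ↥T, ((t' : GL n k) : Matrix n n k) = Df g := ⟨⟨t, ht⟩, hDf_eq.symm⟩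
    have htc_eq : tc g = t := by
      simp only [htc, dif_pos hex]
      exact Units.ext (hex.choose_spec.trans hDf_eq)
    -- the unipotent factors
    obtain ⟨xv, hxv⟩ := hsurj_neg v hv
    obtain ⟨xw, hxw⟩ := hsurj_pos w hw
    have hxc_eq : ∀ i ∈ Lneg, xc i g = xv i := fun i hi => by
      simp only [hxc]; rw [hLf_eq, matCoordFun_coe, hxv, hq_neg xv i hi]
    have hyc_eq : ∀ i ∈ Lpos, yc i g = xw i := fun i hi => by
      simp only [hyc]; rw [hUf_eq, matCoordFun_coe, hxw, hq_pos xw i hi]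
    refine ⟨hΔ, by rw [htc_eq, hDf_eq], ?_⟩
    rw [List.map_congr_left (fun i hi => by rw [hxc_eq i hi]), ← hxv,
      List.map_congr_left (fun i hi => by rw [hyc_eq i hi]), ← hxw, htc_eq]
    exact hgvtw
  -- regularity of the Gauss factors of `A g A⁻¹`, with respect to `dA`, on all of `GL n k`
  have hregL : ∀ i j, IsRegularOnGL Set.univ dA fun g => Lf g i j := fun i j =>
    IsRegularOnGL.const_mul_mul_const _ _
      (fun i j => (isRegularOnGL_gaussL (b := b) (Z := Set.univ) i j).comp_conj A A⁻¹) i j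
  have hregU : ∀ i j, IsRegularOnGL Set.univ dA fun g => Uf g i j := fun i j =>
    IsRegularOnGL.const_mul_mul_const _ _
      (fun i j => (isRegularOnGL_gaussU (b := b) (Z := Set.univ) i j).comp_conj A A⁻¹) i j
  have hregD : ∀ i j, IsRegularOnGL Set.univ dA fun g => Df g i j := fun i j =>
    IsRegularOnGL.const_mul_mul_const _ _
      (fun i j => (isRegularOnGL_gaussD (b := b) (Z := Set.univ) i j).comp_conj A A⁻¹) i j
  -- determinants on the locus `{dA ≠ 0}`
  have hS₁det : ∀ g : GL n k, MvPolynomial.eval (glCoordFun g) dA ≠ 0 →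
      (gaussS₁ b (cj g)).det = 1 ∧ (gaussS₁ b (cj g)ᵀ).det = 1 := fun g hd => by
    rw [hdA_eval, eval_gaussDenom_ne_zero_iff] at hd
    exact ⟨(isBlockUpperUnipotent_gaussS₁ hd).det_eq_one,
      (isBlockUpperUnipotent_gaussS₁_transpose hd).det_eq_one⟩
  have hdetL : ∀ g : GL n k, MvPolynomial.eval (glCoordFun g) dA ≠ 0 → (Lf g).det = 1 := by
    intro g hd
    simp only [hLf, gaussL]
    rw [det_units_conj' A, det_nonsing_inv, det_transpose, (hS₁det g hd).2, Ring.inverse_one]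
  have hdetU : ∀ g : GL n k, MvPolynomial.eval (glCoordFun g) dA ≠ 0 → (Uf g).det = 1 := by
    intro g hd
    simp only [hUf, gaussU]
    rw [det_units_conj' A, det_nonsing_inv, (hS₁det g hd).1, Ring.inverse_one]
  have hdetD : ∀ g : GL n k, MvPolynomial.eval (glCoordFun g) dA ≠ 0 →
      (Df g).det = (g : Matrix n n k).det := by
    intro g hd
    simp only [hDf, gaussD]
    rw [det_units_conj' A, det_mul, det_mul, det_transpose, (hS₁det g hd).1, (hS₁det g hd).2,
      one_mul, mul_one, hcj]
    simp only [Units.val_mul]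
    rw [det_units_conj]
  -- the coordinate functions `xc`, `yc` are regular w.r.t. `dA`
  have hregx : ∀ i, IsRegularOnGL Set.univ dA (xc i) := by
    intro i
    refine IsRegularOnGL.eval_comp (cs := fun c g => matCoordFun (Lf g) c) (fun c => ?_) (qneg i)
    rcases c with ⟨p, q⟩ | uu
    · exact hregL p q
    · exact (IsRegularOnGL.const (1 : k)).congr fun g _ hd => by
        simp only [matCoordFun, Sum.elim_inr, hdetL g hd, inv_one]
  have hregy : ∀ i, IsRegularOnGL Set.univ dA (yc i) := by
    intro i
    refine IsRegularOnGL.eval_comp (cs := fun c g => matCoordFun (Uf g) c) (fun c => ?_) (qpos i)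
    rcases c with ⟨p, q⟩ | uu
    · exact hregU p q
    · exact (IsRegularOnGL.const (1 : k)).congr fun g _ hd => by
        simp only [matCoordFun, Sum.elim_inr, hdetU g hd, inv_one]
  -- passing from `dA` on `GL n k` to `e * dA` on `G`
  have hpass : ∀ {c : GL n k → k} (e : MvPolynomial (GLCoord n) k),
      IsRegularOnGL Set.univ dA c → IsRegularOnGL (G : Set (GL n k)) (e * dA) c :=
    fun e hc => (hc.mono (Set.subset_univ _)).denom_mul e
  have hsplit : ∀ {g : GL n k} {e : MvPolynomial (GLCoord n) k}, e ∈ E →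
      MvPolynomial.eval (glCoordFun g) (e * dA) ≠ 0 →
      (∃ e ∈ E, MvPolynomial.eval (glCoordFun g) e ≠ 0) ∧ MvPolynomial.eval (glCoordFun g) dA ≠ 0 :=
    fun he hd => by
      rw [map_mul] at hd
      exact ⟨⟨_, he, left_ne_zero_of_mul hd⟩, right_ne_zero_of_mul hd⟩
  refine ⟨{
    Lneg := Lneg
    Lpos := Lpos
    D := E.image fun e => e * dA
    xc := xc
    yc := yc
    tc := tc
    one_mem := ?_
    xc_regular := ?_
    yc_regular := ?_
    tc_regular := ?_
    tc_mem := htc_mem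
    prod_eq := ?_ }⟩
  · obtain ⟨e, he, he1⟩ := h1E
    refine ⟨e * dA, Finset.mem_image_of_mem _ he, ?_⟩
    rw [map_mul, hdA_eval, mul_one, mul_inv_cancel, eval_gaussDenom_one, mul_one]
    exact he1
  · intro d hd i
    obtain ⟨e, he, rfl⟩ := Finset.mem_image.mp hd
    exact hpass e (hregx i)
  · intro d hd i
    obtain ⟨e, he, rfl⟩ := Finset.mem_image.mp hd
    exact hpass e (hregy i)
  · intro d hd c
    obtain ⟨e, he, rfl⟩ := Finset.mem_image.mp hd
    rcases c with ⟨p, q⟩ | uu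
    · refine (hpass e (hregD p q)).congr fun g hg hd' => ?_
      obtain ⟨hE, -⟩ := hsplit he hd'
      rw [glCoordFun_inl, (core g hg hE).2.1]
    · refine (hpass e (IsRegularOnGL.coord (Sum.inr uu))).congr fun g hg hd' => ?_
      obtain ⟨hE, hdA0⟩ := hsplit he hd'
      rw [glCoordFun_inr, glCoordFun_inr, (core g hg hE).2.1, hdetD g hdA0]
  · intro g hg hex
    obtain ⟨d, hd, hd0⟩ := hex
    obtain ⟨e, he, rfl⟩ := Finset.mem_image.mp hd
    exact (core g hg (hsplit he hd0).1).2.2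

end Assembly


/-! ### `nonempty_bigCellChart` from Springer 8.2.1 and 8.3.11 -/

section Reduction

variable {k : Type*} [Field k] {n : Type*} [Fintype n] [DecidableEq n]
variable {ι X Y : Type*} [AddCommGroup X] [AddCommGroup Y]
variable {G T : Subgroup (GL n k)} [IsMulCommutative ↥T]

/-- **The open big cell (`nonempty_bigCellChart`, the input to step 2 of Springer's proof of the
isomorphism theorem 9.6.2) follows from Springer 8.2.1 (`posRootGroup_prodIso`) and 8.3.11
(`bigCell_nhds_one`).** Choose a regular coweight `y` (`RootPairing.exists_forall_root'_ne_zero`;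
the roots are finite in number, `IsRootDatumOf.finite_index`) and a matrix `A` diagonalising
the torus `T` (`exists_conj_le_diagonalSubgroup`, Springer 2.4.2 (ii)/3.2.3); let `m_j` be the
weights of the cocharacter `λ_y` in this basis. Root homomorphisms of `y`-positive (negative)
roots become block upper (lower) unipotent for the weight function `-m`
(`IsRootHom.isBlockUpperUnipotent_conj`), `T` becomes diagonal, so for `g = v t w` in the big
cell `A g A⁻¹ = (A v A⁻¹)(A t A⁻¹)(A w A⁻¹)` is a Gauss decomposition in `GL_n`, whose factors
are unique and rational in `g` (`gauss_unique`, `GaussCellGL.lean`); composing with the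
polynomial inverses `q_i` of 8.2.1 gives the regular coordinates `x_i, y_i, t` of the chart
(`nonempty_bigCellChart_of_gauss`). This replaces Springer's appeal to 5.3.2 (iii) for the
regularity of the inverse of `U⁻ × T × U → Ω` in the proof of 8.3.6 (ii).
[cite: SpringerLAG1998, 8.2.1, 8.3.6 (ii), 8.3.11 and the proof of 9.6.2] -/
theorem nonempty_bigCellChart_of_facts
    (hF1 : posRootGroup_prodIso (k := k) (ι := ι) (X := X) (Y := Y) G T)
    (hF2 : bigCell_nhds_one (k := k) (ι := ι) (X := X) (Y := Y) G T) :
    nonempty_bigCellChart (k := k) (ι := ι) (X := X) (Y := Y) (G := G) (T := T) := by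
  intro _ _ hG hT P eX eY h u hu
  classical
  haveI : Finite ι := h.finite_index hG hT
  haveI : Fintype ι := Fintype.ofFinite ι
  obtain ⟨y, hy⟩ := P.exists_forall_root'_ne_zero
  have hy' : ∀ i, P.root' i (-y) ≠ 0 := fun i => by
    rw [map_neg, neg_ne_zero]; exact hy i
  -- numberings of the two positive systems `R⁺(±y)`
  set lpos : List ι := (Finset.univ.filter fun i => 0 < P.root' i y).toList with hlpos
  set lneg : List ι := (Finset.univ.filter fun i => 0 < P.root' i (-y)).toList with hlneg
  have hlpos' : ∀ i, i ∈ lpos ↔ 0 < P.root' i y := fun i => by simp [hlpos]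
  have hlneg' : ∀ i, i ∈ lneg ↔ 0 < P.root' i (-y) := fun i => by simp [hlneg]
  obtain ⟨hsurj_pos, qpos, hq_pos⟩ :=
    hF1 hG hT h u hu y hy lpos (Finset.nodup_toList _) hlpos'
  obtain ⟨hsurj_neg, qneg, hq_neg⟩ :=
    hF1 hG hT h u hu (-y) hy' lneg (Finset.nodup_toList _) hlneg'
  obtain ⟨E, h1E, hΩ⟩ := hF2 hG hT h u hu y hy
  -- diagonalise `T`; the cocharacter `λ_y` and its weights
  obtain ⟨A, hA⟩ := exists_conj_le_diagonalSubgroup hT.2.1.2.1 hT.2.1.2.2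
  set γ : kˣ →* ↥T := cocharOfCoweight eY y with hγdef
  have hγ : IsAlgebraicCochar γ := (Additive.toMul (eY.symm y)).2
  set b : n → ℤ := fun j => -cocharWeight A hA γ j with hb
  have halg : ∀ i, IsAlgebraicChar (charOfWeight eX (P.root i)) := fun i =>
    (Additive.toMul (eX.symm (P.root i))).2
  have hpair : ∀ i, charPairingInt (charOfWeight eX (P.root i)) γ = P.root' i y := by
    intro i
    have e := h.pairing_eq (Additive.toMul (eX.symm (P.root i))) (Additive.toMul (eY.symm y))
    simp only [ofMul_toMul, AddEquiv.apply_symm_apply] at e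
    exact e.symm
  -- block shapes after conjugation by `A`
  have hUpos : ∀ w ∈ posRootGroup G P u y,
      IsBlockUpperUnipotent b ((A * w * A⁻¹ : GL n k) : Matrix n n k) := by
    intro w hw
    have hle : posRootGroup G P u y ≤
        (blockUpperUnipotentGL k b).comap (MulAut.conj A).toMonoidHom := by
      refine iSup_le fun i => ?_
      rintro _ ⟨g, ⟨x, rfl⟩, rfl⟩
      rw [Subgroup.mem_comap, mem_blockUpperUnipotentGL]
      have hx := (hu i.1).isBlockUpperUnipotent_conj (halg i.1) hγ A hA
        (by rw [hpair]; exact i.2) (Multiplicative.toAdd x)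
      rwa [ofAdd_toAdd] at hx
    exact hle hw
  have hUneg : ∀ v ∈ posRootGroup G P u (-y),
      IsBlockLowerUnipotent b ((A * v * A⁻¹ : GL n k) : Matrix n n k) := by
    intro v hv
    have hle : posRootGroup G P u (-y) ≤
        (blockLowerUnipotentGL k b).comap (MulAut.conj A).toMonoidHom := by
      refine iSup_le fun i => ?_
      rintro _ ⟨g, ⟨x, rfl⟩, rfl⟩
      rw [Subgroup.mem_comap, mem_blockLowerUnipotentGL]
      have hneg : charPairingInt (charOfWeight eX (P.root i.1)) γ < 0 := by
        have hi := i.2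
        rw [map_neg] at hi
        rw [hpair]
        exact neg_pos.mp hi
      have hx := (hu i.1).isBlockLowerUnipotent_conj (halg i.1) hγ A hA hneg
        (Multiplicative.toAdd x)
      rwa [ofAdd_toAdd] at hx
    exact hle hv
  have hTd : ∀ t ∈ T, IsBlockDiagonalFor b ((A * t * A⁻¹ : GL n k) : Matrix n n k) := by
    intro t ht i j hij
    have hmem : A * t * A⁻¹ ∈ T.map (MulAut.conj A).toMonoidHom :=
      Subgroup.mem_map.mpr ⟨t, ht, rfl⟩
    have hd := coe_apply_diagCoord hA ⟨A * t * A⁻¹, hmem⟩ i j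
    rw [if_neg (fun hij' => hij (by rw [hij']))] at hd
    exact hd
  exact nonempty_bigCellChart_of_gauss b A u lneg lpos (posRootGroup G P u (-y))
    (posRootGroup G P u y) hUneg hUpos hTd qneg qpos hsurj_neg hq_neg hsurj_pos hq_pos E h1E hΩ

end Reduction

end Literature.NumberTheory.Automorphic

/-! ### Consequences for Chevalley's isomorphism theorem -/

namespace Literature.NumberTheory.Automorphic


variable {k : Type*} [Field k]
variable {ι X Y : Type*} [AddCommGroup X] [AddCommGroup Y]
variable {N N' : ℕ} {G T : Subgroup (GL (Fin N) k)} {G' T' : Subgroup (GL (Fin N') k)}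
  [IsMulCommutative ↥T] [IsMulCommutative ↥T']

/-- **Step 2 of the proof of Springer 9.6.2 from 8.2.1 and 8.3.11**: every abstract isomorphism
`f : G ≃* G'` inducing the identity of the root datum is a morphism of algebraic groups, granted
`posRootGroup_prodIso` (8.2.1) and `bigCell_nhds_one` (8.3.11) for `(G, T)`
(`isAlgebraicGL_of_inducesRootDatumId_of_bigCell` with `nonempty_bigCellChart_of_facts`).
[cite: SpringerLAG1998, 9.6.2 (proof) with 8.2.1 and 8.3.11] -/
theorem isAlgebraicGL_of_inducesRootDatumId_of_facts
    (hF1 : posRootGroup_prodIso (k := k) (ι := ι) (X := X) (Y := Y) G T)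
    (hF2 : bigCell_nhds_one (k := k) (ι := ι) (X := X) (Y := Y) G T) :
    isAlgebraicGL_of_inducesRootDatumId (k := k) (ι := ι) (X := X) (Y := Y) (G := G) (T := T)
      (G' := G') (T' := T') :=
  isAlgebraicGL_of_inducesRootDatumId_of_bigCell (nonempty_bigCellChart_of_facts hF1 hF2)

/-- **`chevalley_isomorphism` from step 1 of Springer's proof and Springer 8.2.1, 8.3.11.** The
named fact `Literature.NumberTheory.Automorphic.chevalley_isomorphism` (Springer 9.6.2, existence clause) follows from
`chevalley_isomorphism_abstract` (step 1 of the proof of 9.6.2: the presentation 9.4.3 with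
9.5.4) together with `posRootGroup_prodIso` (8.2.1) and `bigCell_nhds_one` (8.3.11) for
`(G, T)` and for `(G', T')`. [cite: SpringerLAG1998, 9.6.2 (proof) with 8.2.1 and 8.3.11] -/
theorem chevalley_isomorphism_of_facts
    (hA : chevalley_isomorphism_abstract (k := k) (ι := ι) (X := X) (Y := Y) (G := G) (T := T)
      (G' := G') (T' := T'))
    (hF1 : posRootGroup_prodIso (k := k) (ι := ι) (X := X) (Y := Y) G T)
    (hF2 : bigCell_nhds_one (k := k) (ι := ι) (X := X) (Y := Y) G T)
    (hF1' : posRootGroup_prodIso (k := k) (ι := ι) (X := X) (Y := Y) G' T')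
    (hF2' : bigCell_nhds_one (k := k) (ι := ι) (X := X) (Y := Y) G' T') :
    chevalley_isomorphism (k := k) (ι := ι) (X := X) (Y := Y) (G := G) (T := T) (G' := G')
      (T' := T') :=
  chevalley_isomorphism_of_bigCell hA (nonempty_bigCellChart_of_facts hF1 hF2)
    (nonempty_bigCellChart_of_facts hF1' hF2')

end Literature.NumberTheory.Automorphic

end
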